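import Summits.Ventures.CertifiedManyBodySolver.Rows.SourcedTorusRowsBridge
import Literature.MathematicalPhysics.QuantumLattice.DWaveSourceNNNHoppingWindowCertificate
import HarnessLib

/-!
# PINNING-FIELD rows, part 4: WINDOW certificates instantiate the uniform cells

HONEST FRAMING: first certified bounds on pairing observables; not a superconductivity verdict; every
number certified (two lineages + referee) or labelled float. Nothing is asserted: the window identities are
hypotheses, the conclusions are the typed cells of `Rows/SourcedTorusRows.lean`.

Companion of `Rows/SourcedTorusRows.lean` / `SourcedTorusRowsHook.lean` / `SourcedTorusRowsBridge.lean` (cell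
hubbard-cq, seat hubbard-cq-obsth-1). A producer's certificate for the pinning-field `t–t'` problem is ONE
identity in the window algebra `𝔄_{Λ'}` — independent of the torus side `L` — of the shape consumed by the
tree soundness theorems `dWaveSourceTorusTT'_groundEnergy_ge_of_window_certificate_d4` (energy objective
`E^{src,tt'} = Γ(incl) E^{tt'}_Φ(1,tp,U) − μ Σ_σ n_{0σ} − h (Γ(incl) Φ₀ + (Γ(incl) Φ₀)ᴴ)`) and
`re_orbitState_ge_of_sourced_window_certificate_d4_TT'_ineq_of_energy_le` (objective `Xw` with the energy
constraint `κ (u·1 − E^{src,tt'})`, `κ ≥ 0`): SOS + commutators with the sourced `t–t'` window Hamiltonian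
`pairSourceWindowHamiltonianTT'` + affine-`D₄` defects with `χ_{B₁g}(γₗ) = 1` + `S^z`-charged words +
anti-Hermitian parts + residual words `Σ aₖ vₖ`. This file turns such an identity into the UNIFORM cells:

* `SourcedEnergyLowerRow.of_window_certificate` — `∃ L₀, SourcedEnergyLowerRow tp U μ h q L₀ e` for every
  rational slot `e ≤ c − Σ‖aₖ‖` and every side progression `q`;
* `SourcedCorrLowerRow.of_window_certificate` — `∃ L₀, SourcedCorrLowerRow tp U μ h q L₀ u r Λ' S Xw` for
  every rational slot `r ≤ c − Σ‖aₖ‖` (labels `S ∋ 1` closed under products, `χ_{B₁g} = 1` on `S`, `γₗ ∈ S`).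

`L₀ = max 3 L₁` with `L₁` from `exists_forall_le_injOn_proj (thicken Λ' 1)` (the window and its collar fit
into every torus of side `≥ L₁`). No file-local instance is needed: the cells and the soundness theorems were
elaborated with the same (linear-order) `DecidableEq (FermionTorus 2 L)` instance and meet literally. No
`sorry`, no definition, no named fact.

References: J. Wang et al., PRX 14 (2024) 031006, §III; X. Han, arXiv:2006.06002, §3; T. Koma, H. Tasaki,
J. Stat. Phys. 76 (1994) 745, §1.
-/

noncomputable section

namespace Summit.Ventures.CertifiedManyBodySolver

open Literature.MathematicalPhysics.QuantumLattice
open Matrix HubbardWave0 Literature.Probability.LatticeModels Finset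
open Literature.MathematicalPhysics.QuantumManyBody.StateRelaxation
open scoped BigOperators ComplexOrder

/-- **An ENERGY window certificate for the pair-sourced `t–t'` problem instantiates the uniform FLOOR cell**:
the identity of `dWaveSourceTorusTT'_groundEnergy_ge_of_window_certificate_d4` and a rational slot
`e ≤ c − Σₖ ‖aₖ‖` give `∃ L₀, SourcedEnergyLowerRow tp U μ h q L₀ e` (every side progression `q`). -/
theorem SourcedEnergyLowerRow.of_window_certificate (tp U μ h : ℝ) {e : ℚ} (q : ℕ)
    {Λ Λ' : Finset (Site 2)} (hΛ : Λ ⊆ Λ') (h8 : thicken Λ 1 ⊆ Λ')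
    (h0 : thicken ({0} : Finset (Site 2)) 1 ⊆ Λ') (hz : (0 : Site 2) ∈ Λ')
    (hP : pairRegion (insert (0 : Site 2) unitSteps) 0 ⊆ Λ')
    {m : Type*} [Fintype m] [DecidableEq m] {Λm : Matrix m m ℂ} (hΛm : Λm.PosSemidef)
    (O : m → FermionOp Λ')
    {κ : Type*} (s : Finset κ) (B : κ → FermionOp Λ)
    {ι : Type*} (tt : Finset ι) (gam : ι → DihedralGroup 4) (v : ι → Site 2)
    (hgam : ∀ l ∈ tt, b1gChar (gam l) = 1) (hsh : ∀ l, d4ShiftSet (gam l) (v l) Λ ⊆ Λ') (Y : ι → FermionOp Λ)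
    {χ : Type*} (u : Finset χ) (b : χ → ℂ) (cw : χ → List (Orb (PolySite Λ') × Bool))
    (hcw : ∀ j ∈ u, ladderSpinCharge (cw j) ≠ 0)
    {δ : Type*} (ah : Finset δ) (dc : δ → ℝ) (V : δ → FermionOp Λ')
    {κ'' : Type*} (w : Finset κ'') (a : κ'' → ℂ) (word : κ'' → List (Orb (PolySite Λ') × Bool)) {c : ℝ}
    (hcert : fermionEmbed (PolySite.incl h0) ((hubbardTTPrimeFermionInteraction 1 tp U).meanEnergyObs 1) -
          (μ : ℂ) • ∑ σ : Fin 2, nAt 0 hz σ -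
          (h : ℂ) • (fermionEmbed (PolySite.incl hP) (localPairAt (insert (0 : Site 2) unitSteps) dWaveFormFactor 0) +
            (fermionEmbed (PolySite.incl hP) (localPairAt (insert (0 : Site 2) unitSteps) dWaveFormFactor 0))ᴴ) -
        (c : ℂ) • (1 : FermionOp Λ') =
      gramForm Λm O +
        (∑ k ∈ s, (pairSourceWindowHamiltonianTT' dWaveFormFactor Λ' tp U μ h * fermionEmbed (PolySite.incl hΛ) (B k) -
            fermionEmbed (PolySite.incl hΛ) (B k) * pairSourceWindowHamiltonianTT' dWaveFormFactor Λ' tp U μ h) +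
          ∑ l ∈ tt, (fermionEmbed (PolySite.incl (hsh l)) (fermionEmbed (PolySite.d4Emb (gam l) (v l) Λ) (Y l)) -
            fermionEmbed (PolySite.incl hΛ) (Y l)) +
          ∑ j ∈ u, b j • ladderWord (cw j)) +
        (∑ m' ∈ ah, ((dc m' : ℝ) : ℂ) • ((V m')ᴴ - V m') + ∑ k ∈ w, a k • ladderWord (word k)))
    (he : ((e : ℚ) : ℝ) ≤ c - ∑ k ∈ w, ‖a k‖) :
    ∃ L₀ : ℕ, SourcedEnergyLowerRow tp U μ h q L₀ e := by
  obtain ⟨L₀, hL₀⟩ := dWaveSourceTorusTT'_groundEnergy_ge_of_window_certificate_d4_eventually tp U μ h hΛ h8 h0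
    hz hP hΛm O s B tt gam v hgam hsh Y u b cw hcw ah dc V w a word hcert
  exact ⟨L₀, SourcedEnergyLowerRow.of_certificate_shape_TT' he hL₀⟩

/-- **An OBSERVABLE window certificate for the pair-sourced `t–t'` problem instantiates the uniform
below-cap LOWER cell**: the identity of `re_orbitState_ge_of_sourced_window_certificate_d4_TT'_ineq` for
the objective `Xw` with the energy constraint `κ (u·1 − E^{src,tt'})`, `κ ≥ 0`, labels `S ∋ 1` closed under
products with `χ_{B₁g} = 1` on `S` and `γₗ ∈ S`, and a rational slot `r ≤ c − Σₖ ‖aₖ‖` give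
`∃ L₀, SourcedCorrLowerRow tp U μ h q L₀ u r Λ' S Xw` (every side progression `q`; `L₀ = max 3 L₁`, `L₁`
from `exists_forall_le_injOn_proj (thicken Λ' 1)`). Pair it with a ceiling cell at the same cap `u`
(`SourcedCorrLowerRow.gs_of_energyUpperRow`) before reading it as a statement about ground states. -/
theorem SourcedCorrLowerRow.of_window_certificate (tp U μ h : ℝ) {u r : ℚ} (q : ℕ)
    {Λ Λ' : Finset (Site 2)} (hΛ : Λ ⊆ Λ') (h8 : thicken Λ 1 ⊆ Λ')
    (h0 : thicken ({0} : Finset (Site 2)) 1 ⊆ Λ') (hz : (0 : Site 2) ∈ Λ')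
    (hP : pairRegion (insert (0 : Site 2) unitSteps) 0 ⊆ Λ')
    {S : Finset (DihedralGroup 4)} (h1 : (1 : DihedralGroup 4) ∈ S) (hmul : ∀ a ∈ S, ∀ b ∈ S, a * b ∈ S)
    (hS : ∀ γ ∈ S, b1gChar γ = 1) (Xw : FermionOp Λ') {κ : ℝ} (hκ : 0 ≤ κ)
    {m : Type*} [Fintype m] [DecidableEq m] {Λm : Matrix m m ℂ} (hΛm : Λm.PosSemidef)
    (O : m → FermionOp Λ')
    {κ' : Type*} (s : Finset κ') (B : κ' → FermionOp Λ)
    {ι : Type*} (tt : Finset ι) (γ : ι → DihedralGroup 4) (hγS : ∀ l ∈ tt, γ l ∈ S) (wv : ι → Site 2)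
    (hsh : ∀ l, d4ShiftSet (γ l) (wv l) Λ ⊆ Λ') (Y : ι → FermionOp Λ)
    {ρ : Type*} (uu : Finset ρ) (b : ρ → ℂ) (cw : ρ → List (Orb (PolySite Λ') × Bool))
    (hcw : ∀ j ∈ uu, ladderSpinCharge (cw j) ≠ 0)
    {δ : Type*} (ah : Finset δ) (dc : δ → ℝ) (V : δ → FermionOp Λ')
    {κ'' : Type*} (w : Finset κ'') (a : κ'' → ℂ) (word : κ'' → List (Orb (PolySite Λ') × Bool)) {c : ℝ}
    (hcert : Xw - (c : ℂ) • (1 : FermionOp Λ') -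
        ((κ : ℝ) : ℂ) • ((((u : ℚ) : ℝ) : ℂ) • (1 : FermionOp Λ') -
          (fermionEmbed (PolySite.incl h0) ((hubbardTTPrimeFermionInteraction 1 tp U).meanEnergyObs 1) -
            (μ : ℂ) • ∑ σ : Fin 2, nAt 0 hz σ -
            (h : ℂ) • (fermionEmbed (PolySite.incl hP) (localPairAt (insert (0 : Site 2) unitSteps) dWaveFormFactor 0) +
              (fermionEmbed (PolySite.incl hP) (localPairAt (insert (0 : Site 2) unitSteps) dWaveFormFactor 0))ᴴ))) =
      gramForm Λm O +
        (∑ k ∈ s, (pairSourceWindowHamiltonianTT' dWaveFormFactor Λ' tp U μ h * fermionEmbed (PolySite.incl hΛ) (B k) -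
            fermionEmbed (PolySite.incl hΛ) (B k) * pairSourceWindowHamiltonianTT' dWaveFormFactor Λ' tp U μ h) +
          ∑ l ∈ tt, (fermionEmbed (PolySite.incl (hsh l)) (fermionEmbed (PolySite.d4Emb (γ l) (wv l) Λ) (Y l)) -
            fermionEmbed (PolySite.incl hΛ) (Y l)) +
          ∑ j ∈ uu, b j • ladderWord (cw j)) +
        (∑ m' ∈ ah, ((dc m' : ℝ) : ℂ) • ((V m')ᴴ - V m') + ∑ k ∈ w, a k • ladderWord (word k)))
    (hr : ((r : ℚ) : ℝ) ≤ c - ∑ k ∈ w, ‖a k‖) :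
    ∃ L₀ : ℕ, SourcedCorrLowerRow tp U μ h q L₀ u r Λ' S Xw := by
  obtain ⟨L₁, hL₁⟩ := exists_forall_le_injOn_proj (thicken Λ' 1)
  refine ⟨max 3 L₁, fun L _ hInj' hL _ M E ψ hψ hψ1 hE hEu => ?_⟩
  have hmain := re_orbitState_ge_of_sourced_window_certificate_d4_TT'_ineq_of_energy_le tp U μ h
    (le_trans (le_max_left _ _) hL) hΛ h8 h0 hz hP (hL₁ L (le_trans (le_max_right _ _) hL)) hInj' h1 hmul hS
    hψ hψ1 hE Xw hκ hEu hΛm O s B tt γ hγS wv hsh Y uu b cw hcw ah dc V w a word hcert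
  exact hr.trans hmain

/-- **Both certificates at once ⇒ the uniform GROUND-STATE cell** on the common sides: an observable window
certificate (below-cap LOWER cell at cap `u`) and a uniform energy CEILING cell at the same `u` give
`∃ L₀, SourcedCorrLowerRowGS tp U μ h q L₀ r Λ' S Xw`. -/
theorem SourcedCorrLowerRowGS.of_window_certificate_of_energyUpperRow (tp U μ h : ℝ) {u r : ℚ} {q L₀' : ℕ}
    (hE : SourcedEnergyUpperRow tp U μ h q L₀' u)
    {Λ' : Finset (Site 2)} {S : Finset (DihedralGroup 4)} {Xw : FermionOp Λ'}
    (hrow : ∃ L₀ : ℕ, SourcedCorrLowerRow tp U μ h q L₀ u r Λ' S Xw) :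
    ∃ L₀ : ℕ, SourcedCorrLowerRowGS tp U μ h q L₀ r Λ' S Xw := by
  obtain ⟨L₀, hL₀⟩ := hrow
  exact ⟨max L₀ L₀', hL₀.gs_of_energyUpperRow hE (dvd_refl q)⟩

end Summit.Ventures.CertifiedManyBodySolver

end
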